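import Summits.HubbardSuperconductivity.HubbardSuperconductivity.Theorems.AnisotropyChordTransferFibre3RowDMFormTransform

/-!
# Route `AnisotropyChord` / H0 rotor rung: PartN41-D §5 — `BoundaryLines` PROVED (the three `D`-line sums in pair transforms)

Theory-1 g22's PartN41-D §5 `BoundaryLines` (port …Fibre3KT2aRow; cycle22/calc/boundary_lines.py 1e-14): for profiles vanishing at the origin
(`Fc` even), with `G = v·c0form3(Fa,Fb,Fc) + mform3(Fa,Fb,Fc)`: `G(0,0) = 0` and the boundary sums over the lines `a = 0`, `b = 0`, `a = b`
are `[2C_A(k₃) + C_A(k₃−K₁) + M_A(k₃)] + [2C_B(k₂) + C_B(k₂−K₁) + M_B(k₂)] + [C_D(k₂+k₃) + 2C_D(k₂+k₃−K₁) + M_D(k₂+k₃−K₁)]`.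
★ `boundaryLines_holds : BoundaryLines L` (line by line: ★ `RowD.lineA_sum`, ★ `RowD.lineB_sum`, ★ `RowD.lineD_sum`, ★ `RowD.corner_zero`).
Prover seat `hubbard-h0-rotor-p1` g27 (route lead); helper for stmt-HubbardSuperconductivity-23918 (`--supports`, helper class).
WHAT THIS IS NOT: nothing here proves superconductivity in the Hubbard model.  Tree imports only; no new definitions; no sorry.
-/

set_option linter.dupNamespace false
set_option autoImplicit false

noncomputable section

open scoped BigOperators

namespace Summit.HubbardSuperconductivity.HubbardSuperconductivity.Theorems.AnisotropyChord.Transfer.Fibre3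

variable (L : ℕ) [NeZero L]

namespace RowD

omit [NeZero L] in
/-- the corner: `G(0,0) = 0`. [folklore] -/
theorem corner_zero (Fa Fb Fc : Tor L → ℝ) (hFa0 : Fa 0 = 0) (hFb0 : Fb 0 = 0) (hFc0 : Fc 0 = 0) :
    vfun L (0, 0) * ((c0form3 L Fa Fb Fc (0, 0) : ℝ) : ℂ) + mform3 L Fa Fb Fc (0, 0) = 0 := by
  unfold c0form3 mform3 prod3 Dgrad
  rw [nnList_map_sum]
  simp only [List.map_cons, List.map_nil, List.sum_cons, List.sum_nil, sub_self, zero_sub, zero_add, sub_zero,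
    hFa0, hFb0, hFc0, zero_mul, mul_zero, add_zero, Complex.ofReal_zero, sub_zero]

/-- line `a = 0`: `Σ_b e^{−ik₃b} G(0,b) = 2C_A(k₃) + C_A(k₃−K₁) + M_A(k₃)`. [folklore] -/
theorem lineA_sum (Fa Fb Fc : Tor L → ℝ) (hFa0 : Fa 0 = 0) (k₃ : Tor L) :
    (∑ b : Tor L, (starRingEnd ℂ) (phase L k₃ b) * (vfun L (0, b) * ((c0form3 L Fa Fb Fc (0, b) : ℝ) : ℂ) + mform3 L Fa Fb Fc (0, b)))
      = 2 * bCA L Fa Fb Fc k₃ + bCA L Fa Fb Fc (k₃ - K1 L) + bMA L Fa Fb Fc k₃ := by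
  unfold bCA bMA pairZ dft
  rw [nnList_map_sum_complex, nnList_map_sum_complex]
  simp only [List.map_cons, List.map_nil, List.sum_cons, List.sum_nil, add_zero, conj_phase_sub_K1]
  simp only [Finset.mul_sum, ← Finset.sum_add_distrib]
  refine Finset.sum_congr rfl (fun b _ => ?_)
  unfold vfun c0form3 mform3 prod3 Dgrad
  rw [nnList_map_sum]
  simp only [List.map_cons, List.map_nil, List.sum_cons, List.sum_nil, add_zero, sub_zero, zero_sub, zero_add, neg_neg,
    sub_neg_eq_add, sub_add_cancel, hFa0, phase_zero, zero_mul, sub_self, zero_sub]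
  push_cast
  ring

/-- line `b = 0`: `Σ_a e^{−ik₂a} G(a,0) = 2C_B(k₂) + C_B(k₂−K₁) + M_B(k₂)` (`Fc` even). [folklore] -/
theorem lineB_sum (Fa Fb Fc : Tor L → ℝ) (hFc : ∀ r, Fc (-r) = Fc r) (hFb0 : Fb 0 = 0) (k₂ : Tor L) :
    (∑ a : Tor L, (starRingEnd ℂ) (phase L k₂ a) * (vfun L (a, 0) * ((c0form3 L Fa Fb Fc (a, 0) : ℝ) : ℂ) + mform3 L Fa Fb Fc (a, 0)))
      = 2 * bCB L Fa Fb Fc k₂ + bCB L Fa Fb Fc (k₂ - K1 L) + bMB L Fa Fb Fc k₂ := by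
  unfold bCB bMB pairZ dft
  rw [nnList_map_sum_complex, nnList_map_sum_complex]
  simp only [List.map_cons, List.map_nil, List.sum_cons, List.sum_nil, add_zero, conj_phase_sub_K1]
  simp only [Finset.mul_sum, ← Finset.sum_add_distrib]
  refine Finset.sum_congr rfl (fun a _ => ?_)
  have hFc1 : ∀ e : Tor L, Fc (-a - e) = Fc (a + e) := fun e => by rw [← neg_add', hFc]
  have hFc1' : ∀ e : Tor L, Fc (-a + e) = Fc (a - e) := fun e => by rw [neg_add_eq_sub, ← neg_sub, hFc]
  have hFc2 : ∀ e : Tor L, -e - (a - e) = -a := fun e => by abel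
  have hFc3 : Fc (ex L - a) = Fc (a - ex L) := by rw [← neg_sub, hFc]
  have hFc4 : Fc (-ex L - a) = Fc (a - -ex L) := by rw [← neg_sub, hFc]
  unfold vfun c0form3 mform3 prod3 Dgrad
  rw [nnList_map_sum]
  simp only [List.map_cons, List.map_nil, List.sum_cons, List.sum_nil, add_zero, sub_zero, zero_sub, zero_add, neg_neg,
    sub_neg_eq_add, hFb0, phase_zero, zero_mul, mul_zero, sub_self, hFc, hFc1, hFc1', hFc2]
  rw [hFc3, hFc4]
  push_cast
  ring

/-- diagonal `a = b`: `Σ_a e^{−i(k₂+k₃)a} G(a,a) = C_D(k₂+k₃) + 2C_D(k₂+k₃−K₁) + M_D(k₂+k₃−K₁)`. [folklore] -/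
theorem lineD_sum (Fa Fb Fc : Tor L → ℝ) (hFc0 : Fc 0 = 0) (k₂ k₃ : Tor L) :
    (∑ a : Tor L, (starRingEnd ℂ) (phase L k₂ a * phase L k₃ a) *
        (vfun L (a, a) * ((c0form3 L Fa Fb Fc (a, a) : ℝ) : ℂ) + mform3 L Fa Fb Fc (a, a)))
      = bCD L Fa Fb Fc (k₂ + k₃) + 2 * bCD L Fa Fb Fc (k₂ + k₃ - K1 L) + bMD L Fa Fb Fc (k₂ + k₃ - K1 L) := by
  unfold bCD bMD pairZ dft
  rw [nnList_map_sum_complex, nnList_map_sum_complex]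
  simp only [List.map_cons, List.map_nil, List.sum_cons, List.sum_nil, add_zero, conj_phase_sub_K1, phase_add_left, map_mul]
  simp only [Finset.mul_sum, ← Finset.sum_add_distrib]
  refine Finset.sum_congr rfl (fun a _ => ?_)
  unfold vfun c0form3 mform3 prod3 Dgrad
  rw [nnList_map_sum]
  simp only [List.map_cons, List.map_nil, List.sum_cons, List.sum_nil, add_zero, sub_zero, zero_sub, zero_add, neg_neg,
    sub_neg_eq_add, hFc0, zero_mul, mul_zero, sub_self, sub_add_cancel_left, add_sub_cancel_left]
  push_cast
  ring

end RowD

/-- ★ **`BoundaryLines L` holds.** [folklore] -/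
theorem boundaryLines_holds : BoundaryLines L := by
  intro Fa Fb Fc _hFa _hFb hFc hFa0 hFb0 hFc0 k₂ k₃
  refine ⟨RowD.corner_zero L Fa Fb Fc hFa0 hFb0 hFc0, ?_⟩
  rw [RowD.lineA_sum L Fa Fb Fc hFa0 k₃, RowD.lineB_sum L Fa Fb Fc hFc hFb0 k₂, RowD.lineD_sum L Fa Fb Fc hFc0 k₂ k₃]

end Summit.HubbardSuperconductivity.HubbardSuperconductivity.Theorems.AnisotropyChord.Transfer.Fibre3

end
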